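import Mathlib
import Summits.Ventures.PercRepro2.Defs
import Summits.Ventures.PercRepro2.Graph
import Summits.Ventures.PercRepro2.Events
import Summits.Ventures.PercRepro2.Harris
import Summits.Ventures.PercRepro2.PinnedLaw
import Summits.Ventures.PercRepro2.XWForm

/-!
# (XW) on the complete graph `K₄` for every weight vector and every placement of four distinct
marks (PercRepro2, p2 g24)

(XW) is `0 ≤ xwBil ends s y o u p p` with `a = {s ↔ u}`, `λ = {y ↔ o}`, `S = {s ↔ y}`
(`XWForm.lean`).  On `K₄` (`k4 : Fin 6 → Sym2 (Fin 4)`, edges `01, 02, 03, 12, 13, 23`) with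
ARBITRARY weights — so on every loop-free multigraph on four vertices, a parallel class being one
edge of weight `1 − ∏(1 − p_i)` and an absent edge one of weight `0` — (XW) holds for every
placement of four distinct marks (**`xw_k4`**).  The first 2-connected non-cycle class of the
(XW) line in the kernel.

Proof: the pin induction `xw_of_xwbern` (p2 g22) reduces (XW) to the nonnegativity of every
antipodal (tensor-Bernstein) coefficient at every point mass, an integer statement about the
`2^{|F|}` two-colourings of the free edges `F` of every minor; on `K₄` this is a finite check.
Connectivity on `K₄` is a Boolean formula (`connB`: an open edge, or an open path through one or
two of the other vertices; `conn_iff_connB`), the forms at point masses are integers (`xwZ`,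
`xwAntiZ`; bridges `xwBil_pinned_eq` / `xwAnti_pinned_eq` as in `XWCycleFour.lean`), and the
coefficients are enumerated through the bit encodings `cfg k` of configurations and `maskOf F` of
edge sets (`xwAntiZ_eq_W`), so that ONE kernel `decide` over `Fin 64 × Fin 64` per placement —
`W_nonneg`: `3^6 = 729` minors, `4^6` colourings — settles all `24` placements.  Own work;
standard axioms.
-/

namespace Summit.Ventures.PercRepro2

namespace XWKFour

/-! ## `K₄` and its connectivity as a Boolean -/

/-- The complete graph `K₄` on `Fin 4`: edges `0 = 01, 1 = 02, 2 = 03, 3 = 12, 4 = 13, 5 = 23`. -/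
def k4 : Fin 6 → Sym2 (Fin 4) := ![s(0, 1), s(0, 2), s(0, 3), s(1, 2), s(1, 3), s(2, 3)]

/-- The state of the edge of `K₄` between two vertices (`false` on the diagonal). -/
def edgeB (ω : Config (Fin 6)) (u v : Fin 4) : Bool :=
  match u, v with
  | 0, 1 => ω 0 | 1, 0 => ω 0
  | 0, 2 => ω 1 | 2, 0 => ω 1
  | 0, 3 => ω 2 | 3, 0 => ω 2
  | 1, 2 => ω 3 | 2, 1 => ω 3
  | 1, 3 => ω 4 | 3, 1 => ω 4
  | 2, 3 => ω 5 | 3, 2 => ω 5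
  | _, _ => false

/-- Connectivity on `K₄` as a Boolean: equal, or an open edge, or an open path through one or
both of the other two vertices. -/
def connB (ω : Config (Fin 6)) (u v : Fin 4) : Bool :=
  match u, v with
  | 0, 1 => ω 0 || (ω 1 && ω 3) || (ω 2 && ω 4) || (ω 1 && ω 5 && ω 4) || (ω 2 && ω 5 && ω 3)
  | 0, 2 => ω 1 || (ω 0 && ω 3) || (ω 2 && ω 5) || (ω 0 && ω 4 && ω 5) || (ω 2 && ω 4 && ω 3)
  | 0, 3 => ω 2 || (ω 0 && ω 4) || (ω 1 && ω 5) || (ω 0 && ω 3 && ω 5) || (ω 1 && ω 3 && ω 4)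
  | 1, 0 => ω 0 || (ω 3 && ω 1) || (ω 4 && ω 2) || (ω 3 && ω 5 && ω 2) || (ω 4 && ω 5 && ω 1)
  | 1, 2 => ω 3 || (ω 0 && ω 1) || (ω 4 && ω 5) || (ω 0 && ω 2 && ω 5) || (ω 4 && ω 2 && ω 1)
  | 1, 3 => ω 4 || (ω 0 && ω 2) || (ω 3 && ω 5) || (ω 0 && ω 1 && ω 5) || (ω 3 && ω 1 && ω 2)
  | 2, 0 => ω 1 || (ω 3 && ω 0) || (ω 5 && ω 2) || (ω 3 && ω 4 && ω 2) || (ω 5 && ω 4 && ω 0)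
  | 2, 1 => ω 3 || (ω 1 && ω 0) || (ω 5 && ω 4) || (ω 1 && ω 2 && ω 4) || (ω 5 && ω 2 && ω 0)
  | 2, 3 => ω 5 || (ω 1 && ω 2) || (ω 3 && ω 4) || (ω 1 && ω 0 && ω 4) || (ω 3 && ω 0 && ω 2)
  | 3, 0 => ω 2 || (ω 4 && ω 0) || (ω 5 && ω 1) || (ω 4 && ω 3 && ω 1) || (ω 5 && ω 3 && ω 0)
  | 3, 1 => ω 4 || (ω 2 && ω 0) || (ω 5 && ω 3) || (ω 2 && ω 1 && ω 3) || (ω 5 && ω 1 && ω 0)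
  | 3, 2 => ω 5 || (ω 2 && ω 1) || (ω 4 && ω 3) || (ω 2 && ω 0 && ω 3) || (ω 4 && ω 0 && ω 1)
  | _, _ => true

/-- An open edge of `K₄` between `u` and `v` is an open-adjacency witness. -/
lemma exists_of_edgeB : ∀ (ω : Config (Fin 6)) (u v : Fin 4), edgeB ω u v = true →
    ∃ e : Fin 6, ω e = true ∧ k4 e = s(u, v) := by
  decide

/-- An open-adjacency witness is an open edge of the table. -/
lemma edgeB_of_exists : ∀ (ω : Config (Fin 6)) (u v : Fin 4),
    (∃ e : Fin 6, ω e = true ∧ k4 e = s(u, v)) → edgeB ω u v = true := by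
  decide

/-- `connB` is reflexive. -/
lemma connB_refl : ∀ (ω : Config (Fin 6)) (u : Fin 4), connB ω u u = true := by
  decide

/-- `connB` absorbs an open edge at the end. -/
lemma connB_tail : ∀ (ω : Config (Fin 6)) (u v w : Fin 4),
    connB ω u v = true → edgeB ω v w = true → connB ω u w = true := by
  decide

/-- `connB` unfolds to the existence of an open path of length `≤ 3`. -/
lemma connB_eq_true_iff : ∀ (ω : Config (Fin 6)) (u v : Fin 4), connB ω u v = true ↔
    u = v ∨ edgeB ω u v = true ∨ (∃ w, edgeB ω u w = true ∧ edgeB ω w v = true) ∨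
      ∃ w w', edgeB ω u w = true ∧ edgeB ω w w' = true ∧ edgeB ω w' v = true := by
  decide

/-- An open edge connects. -/
lemma conn_of_edgeB {ω : Config (Fin 6)} {u v : Fin 4} (h : edgeB ω u v = true) :
    Conn k4 ω u v := by
  obtain ⟨e, he, hk⟩ := exists_of_edgeB ω u v h
  exact conn_of_openAdj ⟨e, he, hk⟩

/-- **`connB` is connectivity on `K₄`.** -/
theorem conn_iff_connB (ω : Config (Fin 6)) (u v : Fin 4) :
    Conn k4 ω u v ↔ connB ω u v = true := by
  constructor
  · intro h
    unfold Conn at h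
    rw [SimpleGraph.reachable_iff_reflTransGen] at h
    induction h with
    | refl => exact connB_refl ω u
    | tail _ hadj ih =>
      rw [openGraph_adj] at hadj
      exact connB_tail ω _ _ _ ih (edgeB_of_exists ω _ _ hadj.2)
  · intro h
    rcases (connB_eq_true_iff ω u v).1 h with rfl | h | ⟨w, h1, h2⟩ | ⟨w, w', h1, h2, h3⟩
    · exact conn_refl k4 ω u
    · exact conn_of_edgeB h
    · exact conn_trans (conn_of_edgeB h1) (conn_of_edgeB h2)
    · exact conn_trans (conn_of_edgeB h1) (conn_trans (conn_of_edgeB h2) (conn_of_edgeB h3))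

/-- Membership in a connection event of `K₄`, as a Boolean. -/
lemma mem_connEvent_iff (ω : Config (Fin 6)) (u v : Fin 4) :
    ω ∈ connEvent k4 u v ↔ connB ω u v = true :=
  conn_iff_connB ω u v

/-! ## The integer forms and their bit encodings -/

/-- The indicator of a Boolean, in `ℤ`. -/
def indZ (b : Bool) : ℤ := if b then 1 else 0

/-- `B_W(X, Y)` at two point masses, in `ℤ`. -/
def xwZ (s y o u : Fin 4) (X Y : Config (Fin 6)) : ℤ :=
  indZ (connB X s u && connB X y o) +
    indZ (connB X s y && connB X s u) * indZ (connB Y s y && connB Y y o) -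
    indZ (connB X s u) * indZ (connB Y y o) -
    indZ (connB X s y) * indZ (connB Y s y && connB Y s u && connB Y y o)

/-- The configuration `ζ` overwritten by `η` on `F`. -/
def mix (ζ : Config (Fin 6)) (F : Finset (Fin 6)) (η : Config (Fin 6)) : Config (Fin 6) :=
  fun e => if e ∈ F then η e else ζ e

/-- The antipodal coefficient at the point mass `ζ` on the free edges `F`, in `ℤ`. -/
def xwAntiZ (s y o u : Fin 4) (ζ : Config (Fin 6)) (F : Finset (Fin 6)) : ℤ :=
  ∑ η : Config (Fin 6), xwZ s y o u (mix ζ F η) (mix ζ F (fun e => !η e))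

/-- The configuration with the bits of `k`. -/
def cfg (k : ℕ) : Config (Fin 6) := fun e => k.testBit e.val

/-- The bit encoding of a configuration. -/
def enc (ω : Config (Fin 6)) : ℕ := ∑ e : Fin 6, if ω e then 2 ^ e.val else 0

/-- The bit encoding of an edge set. -/
def maskOf (F : Finset (Fin 6)) : ℕ := ∑ e ∈ F, 2 ^ e.val

/-- `cfg` inverts `enc`. -/
lemma cfg_enc : ∀ ω : Config (Fin 6), cfg (enc ω) = ω := by
  decide

/-- `enc` inverts `cfg` on `Fin 64`. -/
lemma enc_cfg : ∀ k : Fin 64, enc (cfg k.val) = k.val := by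
  decide

/-- The encoding is below `64`. -/
lemma enc_lt : ∀ ω : Config (Fin 6), enc ω < 64 := by
  decide

/-- Membership in an edge set through its mask. -/
lemma mem_iff_testBit : ∀ (F : Finset (Fin 6)) (e : Fin 6), e ∈ F ↔ (maskOf F).testBit e.val := by
  decide

/-- The configurations are the bit patterns of `Fin 64`. -/
def cfgEquiv : Fin 64 ≃ Config (Fin 6) where
  toFun k := cfg k.val
  invFun ω := ⟨enc ω, enc_lt ω⟩
  left_inv k := Fin.ext (enc_cfg k)
  right_inv ω := cfg_enc ω

/-- `mix` through the masks. -/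
def mixM (ζ : Config (Fin 6)) (m : ℕ) (η : Config (Fin 6)) : Config (Fin 6) :=
  fun e => if m.testBit e.val then η e else ζ e

/-- `mix` is `mixM` at the mask of `F`. -/
lemma mix_eq_mixM (ζ : Config (Fin 6)) (F : Finset (Fin 6)) (η : Config (Fin 6)) :
    mix ζ F η = mixM ζ (maskOf F) η := by
  funext e
  simp only [mix, mixM, mem_iff_testBit F e]

/-- **The decided form**: the antipodal coefficient at the point mass `cfg k` on the edges of
the mask `m`, summed over the bit patterns of the colourings. -/
def W (s y o u : Fin 4) (k m : ℕ) : ℤ :=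
  ∑ j : Fin 64, xwZ s y o u (mixM (cfg k) m (cfg j.val)) (mixM (cfg k) m (fun e => !cfg j.val e))

/-- `xwAntiZ` is `W` at the encodings. -/
lemma xwAntiZ_eq_W (s y o u : Fin 4) (ζ : Config (Fin 6)) (F : Finset (Fin 6)) :
    xwAntiZ s y o u ζ F = W s y o u (enc ζ) (maskOf F) := by
  unfold xwAntiZ W
  rw [← Fintype.sum_equiv cfgEquiv (fun k => xwZ s y o u (mixM (cfg (enc ζ)) (maskOf F) (cfg k.val))
      (mixM (cfg (enc ζ)) (maskOf F) (fun e => !cfg k.val e)))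
      (fun η => xwZ s y o u (mix ζ F η) (mix ζ F (fun e => !η e))) (fun k => ?_)]
  simp only [cfgEquiv, Equiv.coe_fn_mk, cfg_enc, mix_eq_mixM]

/-- `mix` does not see `ζ` on `F`. -/
lemma mix_eq_mix_erase (ζ : Config (Fin 6)) (F : Finset (Fin 6)) (η : Config (Fin 6)) :
    mix ζ F η = mix (fun e => if e ∈ F then false else ζ e) F η := by
  funext e
  by_cases he : e ∈ F <;> simp [mix, he]

/-- `xwAntiZ` does not see `ζ` on `F`. -/
lemma xwAntiZ_eq_erase (s y o u : Fin 4) (ζ : Config (Fin 6)) (F : Finset (Fin 6)) :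
    xwAntiZ s y o u ζ F = xwAntiZ s y o u (fun e => if e ∈ F then false else ζ e) F := by
  unfold xwAntiZ
  refine Finset.sum_congr rfl fun η _ => ?_
  rw [mix_eq_mix_erase ζ F η, mix_eq_mix_erase ζ F (fun e => !η e)]

/-- The encoding of a configuration cleared on `F` has no bit on the mask of `F`. -/
lemma enc_erase_land : ∀ (ζ : Config (Fin 6)) (F : Finset (Fin 6)),
    enc (fun e => if e ∈ F then false else ζ e) &&& maskOf F = 0 := by
  decide +kernel

/-- The mask of an edge set is below `64`. -/
lemma maskOf_lt : ∀ F : Finset (Fin 6), maskOf F < 64 := by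
  decide

/-! ## From the point-mass sums to sub-mask sums -/

/-- `mixM` at a point mass cleared on the mask, through the bits. -/
lemma mixM_cfg_eq {k m j : ℕ} (hk : k &&& m = 0) :
    mixM (cfg k) m (cfg j) = cfg (k ||| (j &&& m)) := by
  funext e
  have h : (k &&& m).testBit e.val = false := by rw [hk]; exact Nat.zero_testBit _
  rw [Nat.testBit_land] at h
  simp only [mixM, cfg, Nat.testBit_lor, Nat.testBit_land]
  cases hm : m.testBit e.val <;> cases hkk : k.testBit e.val <;> simp_all

/-- `mixM` with the complementary colouring at a point mass cleared on the mask. -/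
lemma mixM_cfg_not_eq {k m j : ℕ} (hk : k &&& m = 0) :
    mixM (cfg k) m (fun e => !cfg j e) = cfg (k ||| (m ^^^ (j &&& m))) := by
  funext e
  have h : (k &&& m).testBit e.val = false := by rw [hk]; exact Nat.zero_testBit _
  rw [Nat.testBit_land] at h
  simp only [mixM, cfg, Nat.testBit_lor, Nat.testBit_land, Nat.testBit_xor]
  cases hm : m.testBit e.val <;> cases hkk : k.testBit e.val <;> cases hj : j.testBit e.val <;>
    simp_all

/-- `W` as a sum over the bit patterns of `Fin 64`, at a point mass cleared on the mask. -/
lemma W_eq_sum_range (s y o u : Fin 4) {k m : ℕ} (hk : k &&& m = 0) :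
    W s y o u k m = ∑ j ∈ Finset.range 64,
      xwZ s y o u (cfg (k ||| (j &&& m))) (cfg (k ||| (m ^^^ (j &&& m)))) := by
  unfold W
  rw [Finset.sum_range (fun j => xwZ s y o u (cfg (k ||| (j &&& m)))
    (cfg (k ||| (m ^^^ (j &&& m)))))]
  refine Finset.sum_congr rfl fun j _ => ?_
  rw [mixM_cfg_eq hk, mixM_cfg_not_eq hk]

/-- **The decided form**: the antipodal coefficient at the point mass `k` on the mask `m`, as a
sum over the sub-masks `j'` of `m` weighted by the size of the fibre of `j ↦ j &&& m`. -/
def Wsub (s y o u : Fin 4) (k m : ℕ) : ℤ :=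
  ∑ j' ∈ (Finset.range 64).filter (fun j' => j' &&& (63 ^^^ m) = 0),
    (((Finset.range 64).filter (fun j => j &&& m = j')).card : ℤ) *
      xwZ s y o u (cfg (k ||| j')) (cfg (k ||| (m ^^^ j')))

/-- The fibre map lands in the sub-masks. -/
lemma land_mem : ∀ j < 64, ∀ m < 64, j &&& m < 64 ∧ (j &&& m) &&& (63 ^^^ m) = 0 := by
  decide

/-- The sum over the bit patterns is the sub-mask sum. -/
lemma sum_range_eq_Wsub (s y o u : Fin 4) (k : ℕ) {m : ℕ} (hm : m < 64) :
    (∑ j ∈ Finset.range 64,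
      xwZ s y o u (cfg (k ||| (j &&& m))) (cfg (k ||| (m ^^^ (j &&& m))))) = Wsub s y o u k m := by
  unfold Wsub
  rw [← Finset.sum_fiberwise_of_maps_to (s := Finset.range 64)
    (t := (Finset.range 64).filter (fun j' => j' &&& (63 ^^^ m) = 0)) (g := fun j => j &&& m)
    (fun j hj => ?_)]
  · refine Finset.sum_congr rfl fun j' _ => ?_
    rw [Finset.sum_congr rfl (g := fun _ => xwZ s y o u (cfg (k ||| j')) (cfg (k ||| (m ^^^ j'))))
      (fun j hj => ?_), Finset.sum_const, nsmul_eq_mul]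
    rw [Finset.mem_filter] at hj
    rw [hj.2]
  · rw [Finset.mem_range] at hj
    obtain ⟨h1, h2⟩ := land_mem j hj m hm
    rw [Finset.mem_filter, Finset.mem_range]
    exact ⟨h1, h2⟩

/-! ## The finite check -/

set_option maxHeartbeats 0 in
/-- **The `K₄` certificate (decided)**: for four distinct marks, every antipodal coefficient at a
point mass cleared on the mask is nonnegative — the `3^6 = 729` minors of `K₄` and their
`4^6 = 4096` colouring pairs, for each of the `24` placements, in one kernel `decide`. -/
theorem Wsub_nonneg : ∀ s y o u : Fin 4, s ≠ y → s ≠ o → s ≠ u → y ≠ o → y ≠ u → o ≠ u →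
    ∀ m < 64, ∀ k < 64, k &&& m = 0 → 0 ≤ Wsub s y o u k m := by
  decide +kernel

/-- **The `K₄` certificate**: for four distinct marks every antipodal coefficient is
nonnegative. -/
theorem xwAntiZ_nonneg (s y o u : Fin 4) (hsy : s ≠ y) (hso : s ≠ o) (hsu : s ≠ u) (hyo : y ≠ o)
    (hyu : y ≠ u) (hou : o ≠ u) (ζ : Config (Fin 6)) (F : Finset (Fin 6)) :
    0 ≤ xwAntiZ s y o u ζ F := by
  rw [xwAntiZ_eq_erase, xwAntiZ_eq_W, W_eq_sum_range s y o u (enc_erase_land ζ F),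
    sum_range_eq_Wsub s y o u _ (maskOf_lt F)]
  exact Wsub_nonneg s y o u hsy hso hsu hyo hyu hou (maskOf F) (maskOf_lt F) _ (enc_lt _)
    (enc_erase_land ζ F)

/-! ## Bridges from the ring-valued forms to the integer forms -/

section Bridge

variable {R : Type*} [CommRing R] [Nontrivial R]

/-- The probability of an event under a pinned weight vector is the indicator of the forced
configuration, written through a Boolean. -/
lemma prob_pinned_eq_indZ {p : Fin 6 → R} (hp : Pinned.IsPinned p) (A : Set (Config (Fin 6)))
    (b : Bool) (hb : Pinned.pinnedConfig p ∈ A ↔ b = true) :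
    prob p A = ((indZ b : ℤ) : R) := by
  classical
  rw [Pinned.prob_eq_indicator_of_pinned hp, Set.indicator_apply]
  cases b
  · rw [if_neg (fun h => by simpa using hb.1 h)]
    simp [indZ]
  · rw [if_pos (hb.2 rfl)]
    simp [indZ]

/-- Membership in an intersection of two connection events, as a Boolean. -/
lemma mem_inter2_iff (ω : Config (Fin 6)) (a b c d : Fin 4) :
    ω ∈ connEvent k4 a b ∩ connEvent k4 c d ↔ (connB ω a b && connB ω c d) = true := by
  simp only [Set.mem_inter_iff, mem_connEvent_iff, Bool.and_eq_true]

/-- Membership in an intersection of three connection events, as a Boolean. -/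
lemma mem_inter3_iff (ω : Config (Fin 6)) (a b c d e f : Fin 4) :
    ω ∈ connEvent k4 a b ∩ connEvent k4 c d ∩ connEvent k4 e f ↔
      (connB ω a b && connB ω c d && connB ω e f) = true := by
  simp only [Set.mem_inter_iff, mem_connEvent_iff, Bool.and_eq_true]

/-- **`B_W` at two pinned weight vectors is the integer form at the forced configurations.** -/
lemma xwBil_pinned_eq {p q : Fin 6 → R} (hp : Pinned.IsPinned p) (hq : Pinned.IsPinned q)
    (s y o u : Fin 4) :
    xwBil k4 s y o u p q =
      ((xwZ s y o u (Pinned.pinnedConfig p) (Pinned.pinnedConfig q) : ℤ) : R) := by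
  unfold xwBil xwZ
  rw [prob_pinned_eq_indZ hp _ _ (mem_inter2_iff _ s u y o),
    prob_pinned_eq_indZ hp _ _ (mem_inter2_iff _ s y s u),
    prob_pinned_eq_indZ hq _ _ (mem_inter2_iff _ s y y o),
    prob_pinned_eq_indZ hp _ _ (mem_connEvent_iff _ s u),
    prob_pinned_eq_indZ hq _ _ (mem_connEvent_iff _ y o),
    prob_pinned_eq_indZ hp _ _ (mem_connEvent_iff _ s y),
    prob_pinned_eq_indZ hq _ _ (mem_inter3_iff _ s y s u y o)]
  push_cast
  ring

/-- Pinning on `F` keeps a pinned vector pinned. -/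
lemma isPinned_pinOn {p : Fin 6 → R} (hp : Pinned.IsPinned p) (F : Finset (Fin 6))
    (η : Config (Fin 6)) : Pinned.IsPinned (pinOn p F η) := by
  intro e
  by_cases he : e ∈ F
  · cases η e <;> simp [pinOn, he]
  · simp only [pinOn, he, if_false]
    exact hp e

/-- The forced configuration of `pinOn p F η` is `pinnedConfig p` overwritten by `η` on `F`. -/
lemma pinnedConfig_pinOn {p : Fin 6 → R} (F : Finset (Fin 6)) (η : Config (Fin 6)) :
    Pinned.pinnedConfig (pinOn p F η) = mix (Pinned.pinnedConfig p) F η := by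
  funext e
  by_cases he : e ∈ F
  · cases hη : η e <;> simp [Pinned.pinnedConfig, pinOn, mix, he, hη]
  · simp [Pinned.pinnedConfig, pinOn, mix, he]

end Bridge

section BridgeOrdered

variable {R : Type*} [CommRing R] [LinearOrder R] [IsStrictOrderedRing R]

/-- **The antipodal coefficient at a pinned weight vector is the integer antipodal sum.** -/
lemma xwAnti_pinned_eq {p : Fin 6 → R} (hp : Pinned.IsPinned p) (s y o u : Fin 4)
    (F : Finset (Fin 6)) :
    xwAnti k4 s y o u p F = ((xwAntiZ s y o u (Pinned.pinnedConfig p) F : ℤ) : R) := by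
  unfold xwAnti xwAntiZ
  push_cast
  refine Finset.sum_congr rfl fun η _ => ?_
  rw [xwBil_pinned_eq (isPinned_pinOn hp F η) (isPinned_pinOn hp F _), pinnedConfig_pinOn,
    pinnedConfig_pinOn]

/-- **(XW) on `K₄` for every admissible weight vector and every placement of four distinct
marks** — hence on every loop-free multigraph on four vertices (weights `0` for absent edges,
`1 − ∏(1 − p_i)` for a parallel class). -/
theorem xw_k4 (p : Fin 6 → R) (hp : IsProbVec p) (s y o u : Fin 4) (hsy : s ≠ y)
    (hso : s ≠ o) (hsu : s ≠ u) (hyo : y ≠ o) (hyu : y ≠ u) (hou : o ≠ u) :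
    0 ≤ xwBil k4 s y o u p p := by
  refine xw_of_xwbern k4 s y o u ?_ p hp
  intro q _ hpin F
  rw [xwAnti_pinned_eq hpin]
  exact_mod_cast xwAntiZ_nonneg s y o u hsy hso hsu hyo hyu hou (Pinned.pinnedConfig q) F

end BridgeOrdered

end XWKFour

end Summit.Ventures.PercRepro2
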